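import Mathlib
import Literature.Analysis.FluidPDE.NSGalerkinFourier
import Literature.Analysis.FluidPDE.LerayProjectorTorusProofs
import HarnessLib

/-!
# The mean-zero Leray multiplier as a family of continuous linear maps (instab g17, cell `ns-blowup`, 2026-08-27)

HONEST FRAMING (human ruling D-0035): nothing here is a claim about Navier–Stokes blow-up.
WHAT THIS IS NOT: not NS evidence — ONE definition: the modewise Leray symbol of
`Literature.Analysis.FluidPDE.Torus.lerayCoeff` (mean removed at `k = 0`, orthogonal projection onto
`k^⊥` otherwise) BUNDLED as a family `ℤ^d → (ℂ^d →L[ℂ] ℂ^d)` — the shape of the abstract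
parameter `P` of the transport Galerkin model (`TransportGalerkinDefs.linOp/bilOp/box`). It is
assembled from the tree's bundled linear map `Torus.leraySymₗ` (`NSGalerkinFourier`) and agrees
with `Torus.lerayCoeff` pointwise (`lerayCLM_apply`). Self-adjointness and the contraction bound are
proved in the sibling file `TransportGalerkinAbc`.
-/

noncomputable section

namespace Summit.NavierStokesRegularity.FluidComputer.TransportGalerkin

open Literature.Analysis.FluidPDE Literature.Analysis.FluidPDE.Torus

variable {d : Type*} [Fintype d]

/-- **The mean-zero Leray multiplier as continuous linear maps**: `0` at the zero mode, the
bundled `Torus.leraySymₗ k` (projection onto `k^⊥`) otherwise. -/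
def lerayCLM (k : d → ℤ) : EuclideanSpace ℂ d →L[ℂ] EuclideanSpace ℂ d :=
  if k = 0 then 0 else LinearMap.toContinuousLinearMap (leraySymₗ k)

/-- `lerayCLM k` acts as the tree's `Torus.lerayCoeff k`. -/
theorem lerayCLM_apply (k : d → ℤ) (c : EuclideanSpace ℂ d) : lerayCLM k c = lerayCoeff k c := by
  unfold lerayCLM
  split_ifs with hk
  · rw [hk, lerayCoeff_zero]; rfl
  · rw [lerayCoeff_of_ne_zero hk, LinearMap.coe_toContinuousLinearMap', leraySymₗ_apply]

/-- Away from the zero mode `lerayCLM k` is the mean-keeping multiplier `Torus.leraySym k`. -/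
theorem lerayCLM_apply_of_ne_zero {k : d → ℤ} (hk : k ≠ 0) (c : EuclideanSpace ℂ d) :
    lerayCLM k c = leraySym k c := by
  rw [lerayCLM_apply, lerayCoeff_of_ne_zero hk]

/-- At the zero mode `lerayCLM 0 = 0` (mean removed). -/
theorem lerayCLM_zero : (lerayCLM (0 : d → ℤ)) = 0 := by
  unfold lerayCLM; rw [if_pos rfl]

end Summit.NavierStokesRegularity.FluidComputer.TransportGalerkin

end
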